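import Summits.Ventures.HodgeRepro2.T6N3Hyp
import Summits.Ventures.HodgeRepro2.T6N3Bridge
import Summits.Ventures.HodgeRepro2.T6N3Mult
import Summits.Ventures.HodgeRepro2.T6N3Toy

/-!
# T6N3ToyR — the §10.5(ii)(c)/(d) witness for the DISPLAY carriers of N3 and their dictionaries

Cell pub-hodge-repro2, Tier 6 (README §10), seat t6-p3 (N3 owner, M2). Proof lane, count-neutral.
The header of T6N3Hyp describes the joint toy for its four displays in prose («a `RogawskiPackets` with
`Rep = Pkt = PiH = Unit`, `m = 1`, `Ps = Set.univ`, `Pe = Pa = ∅` and a `HoweDualityShape` with `Irr =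
Unit`, … satisfy all four jointly»); this file puts it in kernel, so that EVERY binder of the N3 mains
(`N3A_main` / `N3B_main` / `N3iso_main` of T6N3Main and `N3iso_main₂` of T6N3Main2 — the displays, the
Π_s binder `hs`, the two dictionaries `RogawskiBridge` / `HoweDualityBridge`, and the interface Props
already witnessed on `N3Toy.toy` by T6N3Toy) is instantiated on one toy: `toyR : RogawskiPackets` with
the three Rogawski displays and `hs` (`toyR_partition`, `toyR_thm14_6_4`, `toyR_thm14_6_5`,
`toyR_hs`), the dictionary on the toy datum (`toy_RogawskiBridge`), the Howe-duality shape `toyS` with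
the Gan–Takeda display (`toyS_ganTakeda`) and its dictionary (`toy_HoweDualityBridge`), and the
packaged statements `toy_N3A_main_binders` / `toy_N3iso_binders`.

§8(d): uses an L-value-free non-vanishing device: NO.
-/

namespace Summit.Ventures.HodgeRepro2.T6.N3Toy

open scoped InnerProductSpace

/-! ## 1. The toy packet carrier and Rogawski's displays on it -/

/-- The toy packet carrier: one representation, one packet, `m = 1`, every packet in `Π_s(G′)`,
`Π_e(G′) = Π_a(G′) = ∅`, `N = 0`, no `Π̂′`. -/
def toyR : RogawskiPackets where
  Rep := Unit
  Pkt := Unit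
  mem _ _ := True
  m _ := 1
  Ps := Set.univ
  Pe := ∅
  Pa := ∅
  PiH := Unit
  oneDim _ := True
  pkt' _ := ()
  mnNonzero _ := True
  sqInt _ := True
  N := 0
  cardS _ := 0
  PiHat _ := ∅
  pair _ _ := 1

/-- The partition display holds on the toy (every packet is in `Π_s`). -/
theorem toyR_partition : Hyp.Rogawski1990_Sec14_6_Partition toyR :=
  fun _ _ => Or.inl (Set.mem_univ _)

/-- Theorem 14.6.4 holds on the toy (vacuously: `Π_a = ∅`). -/
theorem toyR_thm14_6_4 : Hyp.Rogawski1990_Thm14_6_4 toyR :=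
  fun _ h => absurd h (Set.notMem_empty _)

/-- Theorem 14.6.5 holds on the toy (vacuously: `Π_e = ∅`). -/
theorem toyR_thm14_6_5 : Hyp.Rogawski1990_Thm14_6_5 toyR :=
  fun _ h => absurd h (Set.notMem_empty _)

/-- The Π_s binder `hs` on the toy (`m = 1`). -/
theorem toyR_hs : ∀ P' ∈ toyR.Ps, ∀ π, toyR.mem π P' → toyR.m π ≤ 1 :=
  fun _ _ _ _ => le_rfl

/-- `m ≤ 1` on the toy from the displays (the consumer of T6N3Mult, instantiated). -/
theorem toyR_multLeOne : toyR.MultLeOne :=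
  toyR.multLeOne_of_displays toyR_partition toyR_thm14_6_4 toyR_thm14_6_5 toyR_hs

/-- The Rogawski dictionary on the toy datum: `m ≤ 1` on the toy packets ⟹ `AutNonIso` on `N3Toy.toy`
(which holds outright there). -/
theorem toy_RogawskiBridge : toy.RogawskiBridge toyR toy_AutStable :=
  fun _ => toy_AutNonIso

/-! ## 2. The toy Howe-duality shape and the Gan–Takeda display on it -/

/-- The toy Howe-duality shape: the trivial group, one representation, `Iso = True`, `θ(π) = ℂ` with
the trivial action. -/
noncomputable def toyS : HoweDualityShape where
  H := Unit
  Irr := Unit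
  Iso _ _ := True
  Vθ _ := ℂ
  θ _ := 1

/-- `dim Hom(θ(π), θ(π′)) ≤ 1` on the toy: the intertwiners are a subspace of `ℂ →ₗ[ℂ] ℂ`, of rank `1`. -/
theorem toyS_dimHom_le_one (π π' : toyS.Irr) : toyS.dimHom π π' ≤ 1 := by
  unfold HoweDualityShape.dimHom
  refine (Submodule.rank_le (toyS.hom π π')).trans ?_
  show Module.rank ℂ (ℂ →ₗ[ℂ] ℂ) ≤ 1
  rw [(LinearMap.ringLmapEquivSelf ℂ ℂ ℂ).rank_eq, Module.rank_self]

/-- The Gan–Takeda display (HD) holds on the toy shape. -/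
theorem toyS_ganTakeda : Hyp.GanTakeda2016_Thm1_2 toyS := by
  intro π π'
  have h : toyS.Iso π π' := trivial
  rw [if_pos h]
  exact toyS_dimHom_le_one π π'

/-- The Howe-duality dictionary on the toy datum, for the constant family of toy shapes: (HD) at every
place ⟹ the isotypic confinement of side A (which holds outright on the toy). -/
theorem toy_HoweDualityBridge : toy.HoweDualityBridge (fun _ : Unit => toyS) toy.A :=
  fun _ => ⟨toy_KliftIsotypic, toy_ThetaMemSigma⟩

/-! ## 3. The packaged joint witnesses -/

/-- EVERY binder of `N3A_main` (T6N3Main) is instantiated on the toy: the display family, the dictionary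
and the eighteen interface Props of side A. -/
theorem toy_N3A_main_binders :
    (∀ v : Unit, Hyp.GanTakeda2016_Thm1_2 ((fun _ : Unit => toyS) v)) ∧
      toy.HoweDualityBridge (fun _ : Unit => toyS) toy.A ∧ toy.A.KliftCont ∧ toy.A.Adjoint ∧
      toy.A.KliftLevel ∧ toy.A.ThetaTauType toy.τiso ∧ toy.A.CopiesEquivariant ∧
      toy.A.CopiesOrthogonal ∧ toy.A.CopiesIncl ∧ toy.A.CopiesTauType ∧ toy.A.TauTypeDecomposes ∧
      toy.A.LevelPartFinite ∧ toy.A.LevelPartCont ∧ toy.A.KAverage ∧ toy.A.ThetaEquivariant ∧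
      toy.A.SpanOfFixedVector ∧ toy.A.CrossCopyOrthogonal ∧ toy.A.CopyIndependence ∧
      toy.A.TensorsSpan :=
  ⟨fun _ => toyS_ganTakeda, toy_HoweDualityBridge, toy_KliftCont, toy_Adjoint, toy_KliftLevel,
    toy_ThetaTauType, toy_CopiesEquivariant, toy_CopiesOrthogonal, toy_CopiesIncl, toy_CopiesTauType,
    toy_TauTypeDecomposes, toy_LevelPartFinite, toy_LevelPartCont, toy_KAverage, toy_ThetaEquivariant,
    toy_SpanOfFixedVector, toy_CrossCopyOrthogonal, toy_CopyIndependence, toy_TensorsSpan⟩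

/-- EVERY binder of `N3iso_main` / `N3iso_main₂` other than the N2-admissibility sentence is
instantiated on the toy: the three Rogawski displays on `toyR`, `hs`, the dictionary, and the eight
interface Props of N3.L8 with `hσ`. -/
theorem toy_N3iso_binders :
    Hyp.Rogawski1990_Sec14_6_Partition toyR ∧ Hyp.Rogawski1990_Thm14_6_4 toyR ∧
      Hyp.Rogawski1990_Thm14_6_5 toyR ∧ (∀ P' ∈ toyR.Ps, ∀ π, toyR.mem π P' → toyR.m π ≤ 1) ∧
      toy.RogawskiBridge toyR toy_AutStable ∧ toy.AutOrthogonal ∧ toy.AutSimple ∧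
      toy.ProductsIn20 toy.A ∧ toy.ProductEquivariant toy.A ∧ toy.ProductsIn20 toy.B ∧
      toy.ProductEquivariant toy.B ∧ toy.SigmaIsAut toy.A ∧ toy.B.σ = toy.A.σ :=
  ⟨toyR_partition, toyR_thm14_6_4, toyR_thm14_6_5, toyR_hs, toy_RogawskiBridge, toy_AutOrthogonal,
    toy_AutSimple, toy_ProductsIn20, toy_ProductEquivariant, toy_ProductsIn20, toy_ProductEquivariant,
    toy_SigmaIsAut, rfl⟩

end Summit.Ventures.HodgeRepro2.T6.N3Toy
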